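import Mathlib
import Summits.ABC.ABC.Statement
import Summits.ABC.ABC.Theorems.SoloInformedWall
import Summits.ABC.ABC.Theorems.SoloInformedBakerXi

/-!
# Quasi-polynomial abc: the rung reached by Baker's weak `Ξ`-estimate
(solo-ABC-informed, session 12)

Baker's *weak* expected estimate for the quantity `Ξ` of a linear form in logarithms,
"`log Ξ ≫ −(log v₁ + ⋯ + log vₙ) log u`, where `u = max |uⱼ|`"
[cite: Baker2004, §2 (p. 256)] [cite: BakerWustholz2007, §3.7 (p. 68)], read for the linear form
`Λ = log(c/a)` of an abc triple (`SoloInformedBakerXi.lean`: the `vⱼ` are the primes of `ca`, so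
`∑ log vⱼ = log rad(ca)`, and `u` bounds the exponents in `ca`; typed with `log max(u,3)` so that
`u ≤ 2` is harmless), yields **quasi-polynomial abc**

  `(W_q)  ∃ K > 0, ∀ (a,b,c), log c ≤ K · log rad(abc) · (1 + log(1 + log c))`

(`soloInformed_quasiPolyABC_of_weakXi`, via `Ξ ≤ rad(b)/max(a,b)` and the admissible
`u = ⌊log₂(ca)⌋ ≤ 3 log c`).  The file then places `W_q` on the seat's door ladder
(`SoloInformedWall.lean`: polynomial abc `W`, subexponential abc `W⁻`):
`W ⟹ W_q` (`soloInformed_quasiPolyABC_of_polynomialABC`), `W_q ⟹ W⁻`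
(`soloInformed_subexpABC_of_quasiPolyABC`: from `L ≤ K t (1 + log(1+L))`, `L = log c`, `t = log N`,
one gets `√(1+L) ≤ 1 + 3Kt`, so `L ≤ 1 + 18K²t² ≤ (1 + 36K²/ε²) N^ε`), and `abc ⟹ W_q`.
So the ladder reads `abc ⟹ W ⟹ W_q ⟹ W⁻`, with the printed doors attached as: Conjecture 3 / the
strong `Ξ`-estimate at `abc`, Philippon's sharpened Liouville inequality at `W`
(`SoloInformedPhilipponDoor.lean`), Baker's weak `Ξ`-estimate at `W_q`, the products-of-heights door
`H(σ)` at `W⁻` (`SoloInformedDoorB.lean`).  No claim is made about the weak estimate itself.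
-/
noncomputable section

open Real UniqueFactorizationMonoid
open Literature.NumberTheory.DiophantineGeometry

namespace Summit.ABC.ABC.Theorems

variable {a b c : ℕ}

/-- Baker's `Ξ` for the linear form `log(c/a)` of the triple `a + b = c`, written out as in
`SoloInformedBakerXi.lean` (no constant is introduced). [cite: Baker2004, §2 (p. 256)] -/
local notation "ΞB(" a ", " b ", " c ")" =>
  (min 1 (Real.log ((c : ℝ) / (a : ℝ))) *
    ∏ p ∈ Nat.primeFactors b, min 1 ((p : ℝ) / (p : ℝ) ^ Nat.factorization b p))

/-! ### The weak `Ξ`-estimate and quasi-polynomial abc -/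

/-- **Baker's weak `Ξ`-estimate gives quasi-polynomial abc.**  The weak form
"`log Ξ ≫ −(log v₁ + ⋯ + log vₙ) log u`" for `Λ = log(c/a)` — the `vⱼ` being the primes of `ca`,
so `∑ log vⱼ = log rad(ca)`, and `u ≥` every exponent in `ca`; typed with `log max(u,3)` so that
`u ≤ 2` is harmless — implies `log c ≤ K' · log rad(abc) · (1 + log(1 + log c))`, by
`Ξ ≤ rad(b)/max(a,b)` and the admissible choice `u = ⌊log₂(ca)⌋ ≤ 3 log c`.
[cite: Baker2004, §2 (p. 256)] [cite: BakerWustholz2007, §3.7 (p. 68)] -/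
theorem soloInformed_quasiPolyABC_of_weakXi {K : ℝ} (hK : 0 ≤ K)
    (hXi : ∀ a b c : ℕ, IsABCTriple a b c → ∀ u : ℕ, (∀ p : ℕ, (c * a).factorization p ≤ u) →
      -(K * Real.log ((radical (c * a) : ℕ) : ℝ) * Real.log ((max u 3 : ℕ) : ℝ)) ≤
        Real.log (ΞB(a, b, c))) :
    ∃ K' : ℝ, 0 < K' ∧ ∀ a b c : ℕ, IsABCTriple a b c →
      Real.log (c : ℝ) ≤
        K' * Real.log ((rad a b c : ℕ) : ℝ) * (1 + Real.log (1 + Real.log (c : ℝ))) := by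
  refine ⟨2 * K + 2, by positivity, fun a b c ht => ?_⟩
  obtain ⟨ha, hb, hc, habc⟩ := soloInformed_xi_triple_pos ht
  have ha0 : (0 : ℝ) < a := by exact_mod_cast ha
  have hc0 : (0 : ℝ) < c := by exact_mod_cast hc
  have hc1 : (1 : ℝ) ≤ c := by exact_mod_cast hc
  have hcab : (c : ℝ) = a + b := by exact_mod_cast habc.symm
  have hlc : 0 ≤ Real.log (c : ℝ) := Real.log_nonneg hc1
  -- the radicals
  have hN2 : (2 : ℝ) ≤ ((rad a b c : ℕ) : ℝ) := by exact_mod_cast ht.two_le_rad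
  set N : ℝ := ((rad a b c : ℕ) : ℝ) with hN_def
  have hNeq : N = ((radical (c * a) : ℕ) : ℝ) * ((radical b : ℕ) : ℝ) := by
    rw [hN_def, soloInformed_rad_eq_radical_mul ht]; push_cast; ring
  have hRca1 : (1 : ℝ) ≤ ((radical (c * a) : ℕ) : ℝ) := by exact_mod_cast Nat.radical_pos _
  have hRb1 : (1 : ℝ) ≤ ((radical b : ℕ) : ℝ) := by exact_mod_cast Nat.radical_pos _
  have hRca_le : ((radical (c * a) : ℕ) : ℝ) ≤ N := by rw [hNeq]; nlinarith
  have hRb_le : ((radical b : ℕ) : ℝ) ≤ N := by rw [hNeq]; nlinarith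
  have hlog2 : (0.6931471803 : ℝ) < Real.log 2 := Real.log_two_gt_d9
  have hlogN2 : Real.log 2 ≤ Real.log N := Real.log_le_log two_pos hN2
  have hlogN0 : 0 < Real.log N := by linarith
  have hRb_log : Real.log ((radical b : ℕ) : ℝ) ≤ Real.log N :=
    Real.log_le_log (by linarith) hRb_le
  have hRca_log : Real.log ((radical (c * a) : ℕ) : ℝ) ≤ Real.log N :=
    Real.log_le_log (by linarith) hRca_le
  -- an admissible exponent bound `u = ⌊log₂ (ca)⌋ ≤ 3 log c`
  set u : ℕ := Nat.log 2 (c * a) with hu_def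
  have hu : ∀ p : ℕ, (c * a).factorization p ≤ u := by
    intro p
    by_cases hp : p.Prime
    · apply Nat.le_log_of_pow_le one_lt_two
      calc 2 ^ (c * a).factorization p ≤ p ^ (c * a).factorization p :=
            Nat.pow_le_pow_left hp.two_le _
        _ ≤ c * a := Nat.ordProj_le p (Nat.mul_pos hc ha).ne'
    · rw [Nat.factorization_eq_zero_of_not_prime _ hp]; exact Nat.zero_le _
  have hu_le : (u : ℝ) ≤ 3 * Real.log c := by
    have hfl : ⌊Real.logb 2 ((c * a : ℕ) : ℝ)⌋₊ = u := by
      rw [hu_def, ← Real.natFloor_logb_natCast 2 (c * a)]; norm_num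
    have h1 : (u : ℝ) ≤ Real.logb 2 ((c * a : ℕ) : ℝ) := by
      rw [← hfl]
      exact Nat.floor_le (Real.logb_nonneg one_lt_two
        (by exact_mod_cast Nat.succ_le_of_lt (Nat.mul_pos hc ha)))
    have hca : Real.log ((c * a : ℕ) : ℝ) ≤ 2 * Real.log c := by
      push_cast
      rw [Real.log_mul hc0.ne' ha0.ne']
      have : Real.log (a : ℝ) ≤ Real.log c := Real.log_le_log ha0 (by linarith)
      linarith
    have h2 : (u : ℝ) * Real.log 2 ≤ 2 * Real.log c := by
      rw [Real.logb, le_div_iff₀ (by linarith)] at h1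
      exact h1.trans hca
    have h4 : (u : ℝ) * Real.log 2 ≤ 3 * Real.log c * Real.log 2 := by
      nlinarith [mul_nonneg hlc (show (0 : ℝ) ≤ Real.log 2 - 2 / 3 by linarith)]
    exact le_of_mul_le_mul_right h4 (by linarith)
  -- `log max(u,3) ≤ 2 (1 + log (1 + log c))`
  have hLL : 0 ≤ Real.log (1 + Real.log (c : ℝ)) := Real.log_nonneg (by linarith)
  have hm1 : (1 : ℝ) ≤ ((max u 3 : ℕ) : ℝ) := by
    exact_mod_cast le_trans (by norm_num) (le_max_right u 3)
  have hmax : Real.log ((max u 3 : ℕ) : ℝ) ≤ 2 * (1 + Real.log (1 + Real.log (c : ℝ))) := by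
    have hm3 : ((max u 3 : ℕ) : ℝ) ≤ 3 * (1 + Real.log (c : ℝ)) := by
      push_cast
      exact max_le (by linarith) (by linarith)
    have hlog3 : Real.log 3 ≤ 2 := by
      have := Real.log_le_sub_one_of_pos (show (0 : ℝ) < 3 by norm_num); linarith
    calc Real.log ((max u 3 : ℕ) : ℝ) ≤ Real.log (3 * (1 + Real.log (c : ℝ))) :=
          Real.log_le_log (by linarith) hm3
      _ = Real.log 3 + Real.log (1 + Real.log (c : ℝ)) :=
          Real.log_mul (by norm_num) (by linarith)
      _ ≤ 2 * (1 + Real.log (1 + Real.log (c : ℝ))) := by linarith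
  -- Baker's weak estimate at `u`, against the upper bound for `Ξ`
  have hXi0 : 0 < ΞB(a, b, c) := soloInformed_bakerXi_pos ht
  have hM0 : (0 : ℝ) < max (a : ℝ) b := lt_max_of_lt_left ha0
  have hup : Real.log (ΞB(a, b, c)) ≤
      Real.log ((radical b : ℕ) : ℝ) - Real.log (max (a : ℝ) b) := by
    rw [← Real.log_div (by positivity) hM0.ne']
    exact Real.log_le_log hXi0 (soloInformed_bakerXi_le ht)
  have hlow := hXi a b c ht u hu
  have h1 : K * Real.log ((radical (c * a) : ℕ) : ℝ) * Real.log ((max u 3 : ℕ) : ℝ) ≤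
      K * Real.log N * (2 * (1 + Real.log (1 + Real.log (c : ℝ)))) :=
    mul_le_mul (mul_le_mul_of_nonneg_left hRca_log hK) hmax (Real.log_nonneg hm1)
      (by positivity)
  have hcmax : Real.log (c : ℝ) ≤ Real.log 2 + Real.log (max (a : ℝ) b) := by
    rw [← Real.log_mul two_ne_zero hM0.ne']
    apply Real.log_le_log hc0
    rw [hcab]; linarith [le_max_left (a : ℝ) b, le_max_right (a : ℝ) b]
  calc Real.log (c : ℝ) ≤ Real.log 2 + Real.log (max (a : ℝ) b) := hcmax
    _ ≤ Real.log N + (Real.log N +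
          K * Real.log N * (2 * (1 + Real.log (1 + Real.log (c : ℝ))))) := by linarith
    _ ≤ (2 * K + 2) * Real.log N * (1 + Real.log (1 + Real.log (c : ℝ))) := by
        nlinarith [mul_nonneg hlogN0.le hLL, mul_nonneg hK hlogN0.le]

/-- Polynomial abc gives quasi-polynomial abc: `log c ≤ log K + M log N ≤ (2|log K| + M + 1) log N`
since `log N ≥ log 2 > 1/2`. [folklore] -/
theorem soloInformed_quasiPolyABC_of_polynomialABC
    (h : ∃ M : ℕ, ∃ K : ℝ, 0 < K ∧
      ∀ a b c : ℕ, IsABCTriple a b c → (c : ℝ) ≤ K * ((rad a b c : ℕ) : ℝ) ^ M) :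
    ∃ K : ℝ, 0 < K ∧ ∀ a b c : ℕ, IsABCTriple a b c →
      Real.log (c : ℝ) ≤
        K * Real.log ((rad a b c : ℕ) : ℝ) * (1 + Real.log (1 + Real.log (c : ℝ))) := by
  obtain ⟨M, K, hK, hK'⟩ := h
  refine ⟨2 * |Real.log K| + M + 1, by positivity, fun a b c ht => ?_⟩
  have hc1 : (1 : ℝ) ≤ c := by
    obtain ⟨ha, hb, habc, _⟩ := ht; exact_mod_cast (show 1 ≤ c by omega)
  have hc0 : (0 : ℝ) < c := by linarith
  have hN2 : (2 : ℝ) ≤ ((rad a b c : ℕ) : ℝ) := by exact_mod_cast ht.two_le_rad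
  set N : ℝ := ((rad a b c : ℕ) : ℝ) with hN_def
  have hN0 : 0 < N := by linarith
  have hlog2 : (0.6931471803 : ℝ) < Real.log 2 := Real.log_two_gt_d9
  have hlogN2 : Real.log 2 ≤ Real.log N := Real.log_le_log two_pos hN2
  have hlogN : 0 < Real.log N := by linarith
  have hLL : 0 ≤ Real.log (1 + Real.log (c : ℝ)) :=
    Real.log_nonneg (by linarith [Real.log_nonneg hc1])
  have h1 : Real.log (c : ℝ) ≤ Real.log K + M * Real.log N := by
    have := Real.log_le_log hc0 (hK' a b c ht)
    rwa [Real.log_mul hK.ne' (pow_pos hN0 _).ne', Real.log_pow] at this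
  have h2 : Real.log K ≤ 2 * |Real.log K| * Real.log N := by
    have := le_abs_self (Real.log K)
    nlinarith [abs_nonneg (Real.log K)]
  calc Real.log (c : ℝ) ≤ (2 * |Real.log K| + M + 1) * Real.log N := by nlinarith
    _ ≤ (2 * |Real.log K| + M + 1) * Real.log N * (1 + Real.log (1 + Real.log (c : ℝ))) := by
        have h0 : 0 ≤ (2 * |Real.log K| + M + 1) * Real.log N := by positivity
        nlinarith

/-- **Quasi-polynomial abc gives subexponential abc**: if `L ≤ K t (1 + log(1 + L))` with
`L = log c ≥ 0`, `t = log rad(abc) > 0`, then `log(1+L) ≤ 2√(1+L)` gives `√(1+L) ≤ 1 + 3Kt`,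
hence `L ≤ 1 + 18K²t² ≤ (1 + 36K²/ε²) N^ε` by `t² ≤ 2e^{εt}/ε²`. [folklore] -/
theorem soloInformed_subexpABC_of_quasiPolyABC
    (h : ∃ K : ℝ, 0 < K ∧ ∀ a b c : ℕ, IsABCTriple a b c →
      Real.log (c : ℝ) ≤
        K * Real.log ((rad a b c : ℕ) : ℝ) * (1 + Real.log (1 + Real.log (c : ℝ)))) :
    ∀ ε : ℝ, 0 < ε → ∃ K : ℝ, 0 < K ∧
      ∀ a b c : ℕ, IsABCTriple a b c → Real.log (c : ℝ) ≤ K * ((rad a b c : ℕ) : ℝ) ^ ε := by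
  obtain ⟨K, hK, hK'⟩ := h
  intro ε hε
  refine ⟨1 + 36 * K ^ 2 / ε ^ 2, by positivity, fun a b c ht => ?_⟩
  have hc1 : (1 : ℝ) ≤ c := by
    obtain ⟨ha, hb, habc, _⟩ := ht; exact_mod_cast (show 1 ≤ c by omega)
  have hW := hK' a b c ht
  have hN2 : (2 : ℝ) ≤ ((rad a b c : ℕ) : ℝ) := by exact_mod_cast ht.two_le_rad
  set N : ℝ := ((rad a b c : ℕ) : ℝ) with hN_def
  set L : ℝ := Real.log (c : ℝ) with hL_def
  have hN0 : 0 < N := by linarith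
  have ht0 : 0 < Real.log N := Real.log_pos (by linarith)
  have hL0 : 0 ≤ L := Real.log_nonneg hc1
  have hKt : 0 < K * Real.log N := mul_pos hK ht0
  -- `s = √(1+L)`
  set s : ℝ := Real.sqrt (1 + L) with hs_def
  have hs1 : 1 ≤ s := Real.one_le_sqrt.mpr (by linarith)
  have hs2 : s ^ 2 = 1 + L := Real.sq_sqrt (by linarith)
  have hl : Real.log (1 + L) ≤ 2 * s := by
    have h1 := Real.log_le_rpow_div (show (0 : ℝ) ≤ 1 + L by linarith)
      (show (0 : ℝ) < 1 / 2 by norm_num)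
    rw [← Real.sqrt_eq_rpow] at h1
    have h2 : Real.sqrt (1 + L) / (1 / 2) = 2 * s := by rw [hs_def]; ring
    linarith [h2]
  have hL1 : L ≤ 3 * (K * Real.log N) * s := by
    calc L ≤ K * Real.log N * (1 + Real.log (1 + L)) := hW
      _ ≤ K * Real.log N * (1 + 2 * s) := mul_le_mul_of_nonneg_left (by linarith) hKt.le
      _ ≤ 3 * (K * Real.log N) * s := by nlinarith
  have hs_le : s ≤ 1 + 3 * (K * Real.log N) := by nlinarith
  have hsq : s ^ 2 ≤ (1 + 3 * (K * Real.log N)) ^ 2 := pow_le_pow_left₀ (by linarith) hs_le 2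
  have hL2 : L ≤ 1 + 18 * K ^ 2 * Real.log N ^ 2 := by
    nlinarith [sq_nonneg (1 - 3 * (K * Real.log N))]
  -- `t² ≤ 2 N^ε / ε²` and `1 ≤ N^ε`
  have hexp : Real.exp (ε * Real.log N) = N ^ ε := by
    rw [Real.rpow_def_of_pos hN0, mul_comm]
  have hq := Real.quadratic_le_exp_of_nonneg (show 0 ≤ ε * Real.log N by positivity)
  rw [hexp] at hq
  have hNε1 : 1 ≤ N ^ ε := Real.one_le_rpow (by linarith) hε.le
  have ht2 : Real.log N ^ 2 ≤ 2 * N ^ ε / ε ^ 2 := by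
    rw [le_div_iff₀ (by positivity)]
    nlinarith [mul_pos hε ht0]
  calc L ≤ 1 + 18 * K ^ 2 * Real.log N ^ 2 := hL2
    _ ≤ N ^ ε + 18 * K ^ 2 * (2 * N ^ ε / ε ^ 2) := by gcongr
    _ = (1 + 36 * K ^ 2 / ε ^ 2) * N ^ ε := by ring

/-- `abc ⟹` quasi-polynomial abc (through polynomial abc). [folklore] -/
theorem soloInformed_quasiPolyABC_of_abc (h : _root_.ABC) :
    ∃ K : ℝ, 0 < K ∧ ∀ a b c : ℕ, IsABCTriple a b c →
      Real.log (c : ℝ) ≤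
        K * Real.log ((rad a b c : ℕ) : ℝ) * (1 + Real.log (1 + Real.log (c : ℝ))) :=
  soloInformed_quasiPolyABC_of_polynomialABC (soloInformed_polynomialABC_of_abc h)

end Summit.ABC.ABC.Theorems

end
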